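import Summits.KontsevichZagierPeriods.KontsevichZagierPeriods.Theorems.SoloBlindLevelNine
import Summits.KontsevichZagierPeriods.KontsevichZagierPeriods.Theorems.SoloBlindLevelEight
import Summits.KontsevichZagierPeriods.KontsevichZagierPeriods.Theorems.SoloBlindTetra
import Summits.KontsevichZagierPeriods.KontsevichZagierPeriods.Theorems.SoloBlindTwelveSporadic
import Summits.KontsevichZagierPeriods.KontsevichZagierPeriods.Theorems.SoloBlindQuartic
import HarnessLib

/-!
# Level 12, first kind: the twelve `S₃`-orbits collapse to two classes

At level `12` the first-kind exponent triples `{k, l, 12-k-l}` form twelve `S₃`-orbits and TWO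
Deligne–Koblitz–Ogus classes:

* `I  = {1,1,10} ∪ {1,5,6} ∪ {2,5,5} ∪ {3,3,6} ∪ {1,3,8} ∪ {3,4,5}` (generator `β(1/12,1/12)`),
* `II = {2,2,8} ∪ {2,4,6} ∪ {4,4,4} ∪ {2,3,7} ∪ {1,2,9} ∪ {1,4,7}` (generator `β(1/6,1/6)`).

Inside the Kontsevich–Zagier rules ALL ten merges are now available: duplication
(`a = 1/12, 5/12, 1/6, 1/3`), mixed duplication (`a = 1/12`), triplication (`a = 1/4, 1/12`),
the quartic family (`x = 1/12`), the tetrahedral descent `β(1/12,1/4) ≐ β(1/4,1/4)`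
(`SoloBlindTetra`) and the sporadic cover merge `β(1/6,1/4) ≐ β(1/6,1/6)`
(`SoloBlindTwelveSporadic`). Hence

* `firstSpan_twelve_eq`: `V₁₂^I = K₀ x_π + K₀ β(1/12,1/12) + K₀ β(1/6,1/6)`;
* `kz_levelTwelveFirst`: if `π, B(1/12,1/12) = Γ(1/12)²/Γ(1/6), B(1/6,1/6) = Γ(1/6)²/Γ(1/3)` are
  linearly independent over `K₀ = ℚ̄ ∩ ℝ` (one value per Deligne–Koblitz–Ogus class), the period
  map is injective on `V₁₂^I`: every `K₀`-linear relation among first-kind level-12 Beta words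
  and `π` with vanishing period follows from the three rules.

References: J. Wolfart, G. Wüstholz, Math. Ann. 273 (1985) 1–15; P. Deligne (appendix by
N. Koblitz, A. Ogus), PSPM 33.2 (1979); N. Aoki, Amer. J. Math. 113 (1991) 779–833.
-/

noncomputable section

open Set

namespace Summit.KontsevichZagierPeriods.KontsevichZagierPeriods.Theorems

namespace SoloBlind

open Literature.NumberTheory.Transcendental
open Literature.NumberTheory.Transcendental.KZ

/-- First-kind orbit representatives at level 12 (one pair per `S₃`-orbit). -/
def reps12 : Finset (ℕ × ℕ) :=
  {(1, 1), (1, 6), (5, 5), (3, 3), (1, 3), (3, 5), (2, 2), (2, 6), (4, 4), (2, 3), (1, 9), (1, 7)}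

/-- `reps12` meets all twelve first-kind `S₃`-orbits at level 12. -/
theorem representsFirst12 : RepresentsFirst 12 reps12 := by decide

/-- The three level-12 generators `x_π, β(1/12,1/12), β(1/6,1/6)`. -/
def twelveGens : Fin 3 → Q := ![xPi, betaQ (1 / 12) (1 / 12), betaQ (1 / 6) (1 / 6)]

/-- The span of the three generators. -/
def twelveSpan : Submodule K₀ Q := Submodule.span K₀ (range twelveGens)

/-! ## Class I -/

/-- `β(1/12,1/12) ∈ ⟨twelveGens⟩`. -/
theorem w11_mem : betaQ (1 / 12) (1 / 12) ∈ twelveSpan := Submodule.subset_span ⟨1, rfl⟩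

/-- `β(1/12,1/2) ∈ ⟨twelveGens⟩` — DUPLICATION (`{1,5,6} ~ {1,1,10}`). -/
theorem w16_mem : betaQ (1 / 12) (1 / 2) ∈ twelveSpan :=
  (betaQ_propTo_dupl (a := 1 / 12) (by norm_num)).symm.mem w11_mem

/-- `β(5/12,1/2) ∈ ⟨twelveGens⟩` (orbit `{1,5,6}`). -/
theorem w56_mem : betaQ (5 / 12) (1 / 2) ∈ twelveSpan := by
  have h := propTo_of_sameOrbit (N := 12) (p := (1, 6)) (q := (5, 6)) (by decide) (by decide)
    (by decide)
  norm_num at h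
  exact h.mem w16_mem

/-- `β(5/12,5/12) ∈ ⟨twelveGens⟩` — DUPLICATION (`{2,5,5} ~ {1,5,6}`). -/
theorem w55_mem : betaQ (5 / 12) (5 / 12) ∈ twelveSpan :=
  (betaQ_propTo_dupl (a := 5 / 12) (by norm_num)).mem w56_mem

/-- `β(1/2,1/12) ∈ ⟨twelveGens⟩` (orbit `{1,5,6}`). -/
theorem w61_mem : betaQ (1 / 2) (1 / 12) ∈ twelveSpan :=
  (betaQ_propTo_symm (a := 1 / 12) (b := 1 / 2) (by norm_num) (by norm_num)).mem w16_mem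

/-- `β(1/4,1/4) ∈ ⟨twelveGens⟩` — TRIPLICATION (`{3,3,6} ~ {1,5,6}`). -/
theorem w33_mem : betaQ (1 / 4) (1 / 4) ∈ twelveSpan := by
  have h := betaQ_propTo_tripl0 (1 / 4) (by norm_num) (by norm_num)
  norm_num at h
  exact h.mem w61_mem

/-- `β(1/12,1/4) ∈ ⟨twelveGens⟩` — TETRAHEDRAL DESCENT (`{1,3,8} ~ {3,3,6}`). -/
theorem w13_mem : betaQ (1 / 12) (1 / 4) ∈ twelveSpan := betaQ_propTo_twelve_quarter.mem w33_mem

/-- `β(1/12,2/3) ∈ ⟨twelveGens⟩` (orbit `{1,3,8}`). -/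
theorem w18_mem : betaQ (1 / 12) (2 / 3) ∈ twelveSpan := by
  have h := propTo_of_sameOrbit (N := 12) (p := (1, 3)) (q := (1, 8)) (by decide) (by decide)
    (by decide)
  norm_num at h
  exact h.mem w13_mem

/-- `β(1/4,5/12) ∈ ⟨twelveGens⟩` — QUARTIC (`{3,4,5} ~ {1,3,8}`). -/
theorem w35_mem : betaQ (1 / 4) (5 / 12) ∈ twelveSpan := by
  have h := betaQ_propTo_quartic (1 / 12) (by norm_num) (by norm_num)
  norm_num at h
  exact h.symm.mem w18_mem

/-! ## Class II -/

/-- `β(1/6,1/6) ∈ ⟨twelveGens⟩`. -/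
theorem w22_mem : betaQ (1 / 6) (1 / 6) ∈ twelveSpan := Submodule.subset_span ⟨2, rfl⟩

/-- `β(1/6,1/2) ∈ ⟨twelveGens⟩` — DUPLICATION (`{2,4,6} ~ {2,2,8}`). -/
theorem w26_mem : betaQ (1 / 6) (1 / 2) ∈ twelveSpan :=
  (betaQ_propTo_dupl (a := 1 / 6) (by norm_num)).symm.mem w22_mem

/-- `β(1/3,1/2) ∈ ⟨twelveGens⟩` (orbit `{2,4,6}`). -/
theorem w46_mem : betaQ (1 / 3) (1 / 2) ∈ twelveSpan := by
  have h := propTo_of_sameOrbit (N := 12) (p := (2, 6)) (q := (4, 6)) (by decide) (by decide)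
    (by decide)
  norm_num at h
  exact h.mem w26_mem

/-- `β(1/3,1/3) ∈ ⟨twelveGens⟩` — DUPLICATION (`{4,4,4} ~ {2,4,6}`). -/
theorem w44_mem : betaQ (1 / 3) (1 / 3) ∈ twelveSpan :=
  (betaQ_propTo_dupl (a := 1 / 3) (by norm_num)).mem w46_mem

/-- `β(1/6,1/4) ∈ ⟨twelveGens⟩` — the SPORADIC COVER MERGE (`{2,3,7} ~ {2,2,8}`). -/
theorem w23_mem : betaQ (1 / 6) (1 / 4) ∈ twelveSpan := betaQ_propTo_twelve_sporadic.mem w22_mem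

/-- `β(1/12,3/4) ∈ ⟨twelveGens⟩` — TRIPLICATION (`{1,2,9} ~ {2,3,7}`). -/
theorem w19_mem : betaQ (1 / 12) (3 / 4) ∈ twelveSpan := by
  have h := betaQ_propTo_tripl0 (1 / 12) (by norm_num) (by norm_num)
  norm_num at h
  exact h.mem w23_mem

/-- `β(1/12,7/12) ∈ ⟨twelveGens⟩` — MIXED DUPLICATION (`{1,4,7} ~ {2,4,6}`). -/
theorem w17_mem : betaQ (1 / 12) (7 / 12) ∈ twelveSpan := by
  have h := betaQ_propTo_mixed (a := 1 / 12) (by norm_num)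
  norm_num at h
  exact h.mem w26_mem

/-! ## The sector -/

/-- **`V₁₂^I ⊆ ⟨x_π, β(1/12,1/12), β(1/6,1/6)⟩`.** -/
theorem firstSpan_twelve_le : firstSpan 12 ≤ twelveSpan := by
  refine firstSpan_le representsFirst12 (Submodule.subset_span ⟨0, rfl⟩) ?_
  intro p hp
  simp only [reps12, Finset.mem_insert, Finset.mem_singleton] at hp
  rcases hp with rfl | rfl | rfl | rfl | rfl | rfl | rfl | rfl | rfl | rfl | rfl | rfl
  · norm_num; exact w11_mem
  · norm_num; exact w16_mem
  · norm_num; exact w55_mem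
  · norm_num; exact w33_mem
  · norm_num; exact w13_mem
  · norm_num; exact w35_mem
  · norm_num; exact w22_mem
  · norm_num; exact w26_mem
  · norm_num; exact w44_mem
  · norm_num; exact w23_mem
  · norm_num; exact w19_mem
  · norm_num; exact w17_mem

/-- The three generators lie in `V₁₂^I`, so `V₁₂^I` IS their span. -/
theorem firstSpan_twelve_eq : firstSpan 12 = twelveSpan := by
  refine le_antisymm firstSpan_twelve_le (Submodule.span_le.mpr ?_)
  rintro x ⟨i, rfl⟩
  fin_cases i
  · exact xPi_mem_firstSpan 12
  · exact Submodule.subset_span (mem_insert_of_mem _ ⟨1, 1, 0, 0, le_rfl, le_rfl, by norm_num,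
      by norm_num [twelveGens]⟩)
  · exact Submodule.subset_span (mem_insert_of_mem _ ⟨2, 2, 0, 0, by norm_num, by norm_num,
      by norm_num, by norm_num [twelveGens]⟩)

/-- The periods of the generators: `(π, Γ(1/12)²/Γ(1/6), Γ(1/6)²/Γ(1/3))`. -/
theorem evalQ_twelveGens : (fun i => evalQ (twelveGens i)) =
    ![Real.pi, Real.Gamma (1 / 12) * Real.Gamma (1 / 12) / Real.Gamma (1 / 6),
      Real.Gamma (1 / 6) * Real.Gamma (1 / 6) / Real.Gamma (1 / 3)] := by
  funext i
  fin_cases i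
  · exact evalQ_xPi
  · show evalQ (betaQ (1 / 12) (1 / 12)) = _
    rw [evalQ_betaQ (by norm_num) (by norm_num)]; norm_num
  · show evalQ (betaQ (1 / 6) (1 / 6)) = _
    rw [evalQ_betaQ (by norm_num) (by norm_num)]; norm_num

/-- **The first-kind linear sector at level 12.** If `π, Γ(1/12)²/Γ(1/6), Γ(1/6)²/Γ(1/3)` — one
value per Deligne–Koblitz–Ogus class — are linearly independent over `K₀ = ℚ̄ ∩ ℝ`, the period map
is injective on `V₁₂^I`: every `K₀`-linear relation among first-kind level-12 Beta words and `π`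
with vanishing period is a consequence of the three Kontsevich–Zagier rules (the proof USES the
tetrahedral descent and the sporadic cover merge, neither of which is a Gauss/duplication/
triplication instance). -/
theorem kz_levelTwelveFirst (h : LinearIndependent K₀ fun i => evalQ (twelveGens i)) {z : Q}
    (hz : z ∈ firstSpan 12) (h0 : evalQ z = 0) : z = 0 :=
  kz_first_of_le firstSpan_twelve_le h hz h0

/-- The period map is injective on `V₁₂^I` (same hypothesis). -/
theorem evalQ_injOn_firstSpan_twelve (h : LinearIndependent K₀ fun i => evalQ (twelveGens i)) :
    InjOn evalQ (firstSpan 12) := fun x hx y hy hxy => sub_eq_zero.mp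
  (kz_levelTwelveFirst h ((firstSpan 12).sub_mem hx hy) (by rw [map_sub, hxy, sub_self]))

end SoloBlind

end Summit.KontsevichZagierPeriods.KontsevichZagierPeriods.Theorems
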